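import Literature.Computability.QuantumComplexity.GadgetInstances
import Literature.Computability.QuantumComplexity.GadgetFlag
import HarnessLib

/-!
# The control conditions of the AJL letter gadgets as Boolean expressions

Topic `Literature/Computability/QuantumComplexity`; a step in the discharge of
`ajl_jonesApproxProblem_mem_PromiseBQP`. The five gadgets of a letter (`LetterTargets.lean`) are
controlled by the Hadamard-test qubit `q`, the letter-table bit `w` and conditions on the three vertex
registers (`Cond₂`, `Cond₃`, `ECond` of `JonesLocalGateCircuit.lean`). Read through the gadget layouts
(`GadgetFlag.GadgetLayout` with further inputs `ins = [t, q, w, …vertex bits…]`), these are Boolean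
expressions over the input bits at offsets `≥ k + 2` (`SLP.BExpr.ReadsHigh`):

* `ctlRotB k z` (`z = 2, 3`) with `ctlRotB_eval`: at `2^{k+2}·rest`, `rest = bitsToNat [q, w, e₀, e₁, e₃, e₄, e₅]`,
  the value is `[q ∧ w ∧ Cond_z]`;
* `ctlPhaseB k` with `ctlPhaseB_eval`: at `rest = bitsToNat [q, w, e₀, …, e₅]` the value is `[q ∧ w ∧ ECond]`;
* the bit-pattern forms of `Cond₂`, `Cond₃`, `ECond` (`cond₂_iff_bits`, `cond₃_iff_bits`, `econd_iff_bits`).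

## References

* D. Aharonov, V. Jones, Z. Landau, Algorithmica 55 (2009), Claim 4.1 [AharonovJonesLandau2009].
-/

noncomputable section

namespace Literature.Computability.QuantumComplexity

open Literature.Computability.Complexity (bitsToNat bitsToNat_cons)
open Literature.Computability.Complexity.Com (testBit_bitsToNat)

open Cryptography

namespace SLP

/-! ### Conjunctions of literals over high bits -/

/-- The literal `bit off = v`. [folklore] -/
def litB (off : ℕ) (v : Bool) : BExpr := if v then bitB off else .not (bitB off)

/-- Semantics of a literal. [folklore] -/
@[simp] theorem litB_eval (inp off : ℕ) (v : Bool) : (litB off v).eval inp = (inp.testBit off == v) := by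
  unfold litB; cases v <;> simp [BExpr.eval, bitB_eval]

/-- A literal at offset `≥ k` reads high. [folklore] -/
theorem litB_readsHigh {k off : ℕ} (h : k ≤ off) (v : Bool) : (litB off v).ReadsHigh k := by
  unfold litB; cases v
  · exact bitB_readsHigh h
  · exact bitB_readsHigh h

/-- The conjunction of the literals `bit (base + j) = vs[j]` (for the empty list, the constant `true`
as `bit 0 ∨ ¬bit 0`). [folklore] -/
def conjB : ℕ → List Bool → BExpr
  | _, [] => trueB 0
  | base, [v] => litB base v
  | base, v :: w :: vs => .and (litB base v) (conjB (base + 1) (w :: vs))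

/-- Semantics of a conjunction of literals. [folklore] -/
theorem conjB_eval (inp : ℕ) : ∀ (base : ℕ) (vs : List Bool),
    (conjB base vs).eval inp = decide (∀ j, j < vs.length → inp.testBit (base + j) = vs.getD j false)
  | base, [] => by simp [conjB]
  | base, [v] => by
    rw [conjB, litB_eval]
    apply Bool.eq_iff_iff.2
    simp only [beq_iff_eq, decide_eq_true_iff, List.length_cons, List.length_nil]
    constructor
    · intro h j hj; have : j = 0 := by omega
      subst this; simpa using h
    · intro h; simpa using h 0 (by omega)
  | base, v :: w :: vs => by
    rw [conjB, BExpr.eval, litB_eval, conjB_eval inp (base + 1) (w :: vs)]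
    apply Bool.eq_iff_iff.2
    simp only [Bool.and_eq_true, beq_iff_eq, decide_eq_true_iff, List.length_cons]
    constructor
    · rintro ⟨h0, h1⟩ j hj
      cases j with
      | zero => simpa using h0
      | succ j => rw [List.getD_cons_succ, show base + (j + 1) = base + 1 + j by omega]; exact h1 j (by simp at hj ⊢; omega)
    · intro h
      refine ⟨by simpa using h 0 (by omega), fun j hj => ?_⟩
      have := h (j + 1) (by simp at hj ⊢; omega)
      rwa [show base + (j + 1) = base + 1 + j by omega, List.getD_cons_succ] at this

/-- A nonempty conjunction of literals at offsets `≥ k` reads high. [folklore] -/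
theorem conjB_readsHigh {k : ℕ} : ∀ {base : ℕ} (_ : k ≤ base) (vs : List Bool), vs ≠ [] → (conjB base vs).ReadsHigh k
  | _, _, [], h => absurd rfl h
  | base, h, [v], _ => litB_readsHigh h v
  | base, h, v :: w :: vs, _ => ⟨litB_readsHigh h v, conjB_readsHigh (base := base + 1) (by omega) (w :: vs) (by simp)⟩

/-- Bits of `2^m · rest`. [folklore] -/
theorem testBit_two_pow_mul (m rest j : ℕ) : (2 ^ m * rest).testBit (m + j) = rest.testBit j := by
  rw [show 2 ^ m * rest = 2 ^ m * rest + 0 from rfl, Nat.testBit_two_pow_mul_add _ (Nat.two_pow_pos m), if_neg (by omega),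
    Nat.add_sub_cancel_left]

/-! ### The vertex conditions as bit patterns -/

/-- `Cond₂` as a bit pattern: `(x₀, x₁) = (0,1)`, `(x₄, x₅) = (0,1)`, `x₃ = 0`. [folklore] -/
theorem cond₂_iff_bits (x : QReg 6) : Cond₂ x ↔ (x 0 = false ∧ x 1 = true ∧ x 3 = false ∧ x 4 = false ∧ x 5 = true) := by
  revert x; unfold Cond₂ vL vR vertexOfBits; decide

/-- `Cond₃` as a bit pattern: `(x₀, x₁) = (1,0)`, `(x₄, x₅) = (1,0)`, `x₃ = 1`. [folklore] -/
theorem cond₃_iff_bits (x : QReg 6) : Cond₃ x ↔ (x 0 = true ∧ x 1 = false ∧ x 3 = true ∧ x 4 = true ∧ x 5 = false) := by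
  revert x; unfold Cond₃ vL vR vertexOfBits; decide

/-- `ECond` as bit patterns: `(L, M, R) ∈ {(1,2,1), (2,1,2), (3,2,3), (4,3,4)}`. [folklore] -/
theorem econd_iff_bits (x : QReg 6) : ECond x ↔
    ((x 0 = false ∧ x 1 = false ∧ x 2 = false ∧ x 3 = true ∧ x 4 = false ∧ x 5 = false) ∨
     (x 0 = false ∧ x 1 = true ∧ x 2 = false ∧ x 3 = false ∧ x 4 = false ∧ x 5 = true) ∨
     (x 0 = true ∧ x 1 = false ∧ x 2 = false ∧ x 3 = true ∧ x 4 = true ∧ x 5 = false) ∨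
     (x 0 = true ∧ x 1 = true ∧ x 2 = true ∧ x 3 = false ∧ x 4 = true ∧ x 5 = true)) := by
  revert x; unfold ECond eRef vL vM vR vertexOfBits; decide

/-! ### The control expressions -/

/-- **The control of the rotation gadgets**: `q ∧ w ∧ Cond_z`, over the further inputs
`[t = e₂, q, w, e₀, e₁, e₃, e₄, e₅]` (offsets `k+1, …, k+8`). [cite: AharonovJonesLandau2009, Claim 4.1] -/
def ctlRotB (k : ℕ) (z : ℤ) : BExpr :=
  conjB (k + 2) (if z = 2 then [true, true, false, true, false, false, true] else [true, true, true, false, true, true, false])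

/-- **The control of the phase gadget**: `q ∧ w ∧ ECond`, over the further inputs
`[d₀, q, w, e₀, e₁, e₂, e₃, e₄, e₅]` (offsets `k+1, …, k+9`). [cite: AharonovJonesLandau2009, Claim 4.1] -/
def ctlPhaseB (k : ℕ) : BExpr :=
  .and (conjB (k + 2) [true, true])
    (.or (.or (conjB (k + 4) [false, false, false, true, false, false]) (conjB (k + 4) [false, true, false, false, false, true]))
      (.or (conjB (k + 4) [true, false, false, true, true, false]) (conjB (k + 4) [true, true, true, false, true, true])))

/-- The rotation control reads high. [folklore] -/
theorem ctlRotB_readsHigh (k : ℕ) (z : ℤ) : (ctlRotB k z).ReadsHigh (k + 2) := by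
  unfold ctlRotB; split_ifs <;> exact conjB_readsHigh le_rfl _ (by simp)

/-- The phase control reads high. [folklore] -/
theorem ctlPhaseB_readsHigh (k : ℕ) : (ctlPhaseB k).ReadsHigh (k + 2) :=
  ⟨conjB_readsHigh le_rfl _ (by simp), ⟨⟨conjB_readsHigh (by omega) _ (by simp), conjB_readsHigh (by omega) _ (by simp)⟩,
    ⟨conjB_readsHigh (by omega) _ (by simp), conjB_readsHigh (by omega) _ (by simp)⟩⟩⟩

variable {N : ℕ}

/-- **Semantics of the rotation control.** With `rest = bitsToNat [z q, z w, z e₀, z e₁, z e₃, z e₄, z e₅]`: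
`ctlRotB k 2` at `2^{k+2}·rest` is `[z q ∧ z w ∧ Cond₂ (z ∘ e)]`, and likewise for `3`. [cite: AharonovJonesLandau2009, Claim 4.1] -/
theorem ctlRotB_eval (k : ℕ) (e : Fin 6 ↪ Fin N) (q w : Fin N) (z : QReg N) :
    (ctlRotB k 2).eval (2 ^ (k + 2) * bitsToNat [z q, z w, z (e 0), z (e 1), z (e 3), z (e 4), z (e 5)]) =
      decide (z q = true ∧ z w = true ∧ Cond₂ (z ∘ e)) ∧
    (ctlRotB k 3).eval (2 ^ (k + 2) * bitsToNat [z q, z w, z (e 0), z (e 1), z (e 3), z (e 4), z (e 5)]) =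
      decide (z q = true ∧ z w = true ∧ Cond₃ (z ∘ e)) := by
  have hb : ∀ j, (2 ^ (k + 2) * bitsToNat [z q, z w, z (e 0), z (e 1), z (e 3), z (e 4), z (e 5)]).testBit (k + 2 + j) =
      [z q, z w, z (e 0), z (e 1), z (e 3), z (e 4), z (e 5)].getD j false := fun j => by
    rw [testBit_two_pow_mul, testBit_bitsToNat]
  constructor
  · rw [ctlRotB, if_pos rfl, conjB_eval]
    apply Bool.decide_congr
    rw [cond₂_iff_bits]
    simp only [List.length_cons, List.length_nil, Function.comp_apply]
    constructor
    · intro h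
      have h0 := h 0 (by omega); have h1 := h 1 (by omega); have h2 := h 2 (by omega); have h3 := h 3 (by omega)
      have h4 := h 4 (by omega); have h5 := h 5 (by omega); have h6 := h 6 (by omega)
      rw [hb] at h0 h1 h2 h3 h4 h5 h6
      simp at h0 h1 h2 h3 h4 h5 h6
      exact ⟨h0, h1, h2, h3, h4, h5, h6⟩
    · rintro ⟨h0, h1, h2, h3, h4, h5, h6⟩ j hj
      rw [hb]
      interval_cases j <;> simp [h0, h1, h2, h3, h4, h5, h6]
  · rw [ctlRotB, if_neg (by norm_num), conjB_eval]
    apply Bool.decide_congr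
    rw [cond₃_iff_bits]
    simp only [List.length_cons, List.length_nil, Function.comp_apply]
    constructor
    · intro h
      have h0 := h 0 (by omega); have h1 := h 1 (by omega); have h2 := h 2 (by omega); have h3 := h 3 (by omega)
      have h4 := h 4 (by omega); have h5 := h 5 (by omega); have h6 := h 6 (by omega)
      rw [hb] at h0 h1 h2 h3 h4 h5 h6
      simp at h0 h1 h2 h3 h4 h5 h6
      exact ⟨h0, h1, h2, h3, h4, h5, h6⟩
    · rintro ⟨h0, h1, h2, h3, h4, h5, h6⟩ j hj
      rw [hb]
      interval_cases j <;> simp [h0, h1, h2, h3, h4, h5, h6]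

/-- **Semantics of the phase control.** With `rest = bitsToNat [z q, z w, z e₀, …, z e₅]`:
`ctlPhaseB k` at `2^{k+2}·rest` is `[z q ∧ z w ∧ ECond (z ∘ e)]`. [cite: AharonovJonesLandau2009, Claim 4.1] -/
theorem ctlPhaseB_eval (k : ℕ) (e : Fin 6 ↪ Fin N) (q w : Fin N) (z : QReg N) :
    (ctlPhaseB k).eval (2 ^ (k + 2) * bitsToNat [z q, z w, z (e 0), z (e 1), z (e 2), z (e 3), z (e 4), z (e 5)]) =
      decide (z q = true ∧ z w = true ∧ ECond (z ∘ e)) := by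
  set inp := 2 ^ (k + 2) * bitsToNat [z q, z w, z (e 0), z (e 1), z (e 2), z (e 3), z (e 4), z (e 5)] with hinp
  have hb : ∀ j, inp.testBit (k + 2 + j) = [z q, z w, z (e 0), z (e 1), z (e 2), z (e 3), z (e 4), z (e 5)].getD j false := fun j => by
    rw [hinp, testBit_two_pow_mul, testBit_bitsToNat]
  have hb' : ∀ j, inp.testBit (k + 4 + j) = [z (e 0), z (e 1), z (e 2), z (e 3), z (e 4), z (e 5)].getD j false := fun j => by
    rw [show k + 4 + j = k + 2 + (j + 2) by omega, hb]; rfl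
  -- the five conjunctions as propositions on the label
  have e_qw : (∀ j, j < [true, true].length → inp.testBit (k + 2 + j) = [true, true].getD j false) ↔ (z q = true ∧ z w = true) := by
    simp only [List.length_cons, List.length_nil]
    constructor
    · intro h
      have a := h 0 (by omega); have b := h 1 (by omega)
      rw [hb] at a b; simp at a b; exact ⟨a, b⟩
    · rintro ⟨a, b⟩ j hj; rw [hb]; interval_cases j <;> simp [a, b]
  have e_pat : ∀ (v0 v1 v2 v3 v4 v5 : Bool),
      (∀ j, j < [v0, v1, v2, v3, v4, v5].length → inp.testBit (k + 4 + j) = [v0, v1, v2, v3, v4, v5].getD j false) ↔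
        (z (e 0) = v0 ∧ z (e 1) = v1 ∧ z (e 2) = v2 ∧ z (e 3) = v3 ∧ z (e 4) = v4 ∧ z (e 5) = v5) := by
    intro v0 v1 v2 v3 v4 v5
    simp only [List.length_cons, List.length_nil]
    constructor
    · intro h
      have a0 := h 0 (by omega); have a1 := h 1 (by omega); have a2 := h 2 (by omega)
      have a3 := h 3 (by omega); have a4 := h 4 (by omega); have a5 := h 5 (by omega)
      rw [hb'] at a0 a1 a2 a3 a4 a5
      simp at a0 a1 a2 a3 a4 a5
      exact ⟨a0, a1, a2, a3, a4, a5⟩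
    · rintro ⟨a0, a1, a2, a3, a4, a5⟩ j hj
      rw [hb']
      interval_cases j <;> simp [a0, a1, a2, a3, a4, a5]
  rw [ctlPhaseB, BExpr.eval, BExpr.eval, BExpr.eval, BExpr.eval, conjB_eval, conjB_eval, conjB_eval, conjB_eval, conjB_eval,
    ← Bool.decide_or, ← Bool.decide_or, ← Bool.decide_or, ← Bool.decide_and]
  apply Bool.decide_congr
  rw [econd_iff_bits, e_qw, e_pat, e_pat, e_pat, e_pat]
  simp only [Function.comp_apply, and_assoc, or_assoc]

end SLP

end Literature.Computability.QuantumComplexity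

end
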